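import Summits.ValiantsHypothesis.ValiantsHypothesis.Theorems.NewtonUnitEquationsTwoProductsRankOneThreeGenLawCount
import Summits.ValiantsHypothesis.ValiantsHypothesis.Theorems.NewtonUnitEquationsTwoProductsRankOneSimplexCount
import Summits.ValiantsHypothesis.ValiantsHypothesis.Theorems.TwoProducts.Negative.OneSidedMembership
import HarnessLib

/-!
# Route NewtonUnitEquations — crux `TwoProducts` (stmt-ValiantsHypothesis-5906), line `relation_ladder`, rung R9 (the RANK-ONE
# SCHEMA law: ONE datum `(ρ⁺, ρ⁻)` of ANY shape) by the TRANSPORTATION LIFT — part 1/8 — general relation data `GIdx`, the transportation substitution `frM` on `σ ⊕ σ × σ` and its table sums (T2)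

THE RANK-ONE SCHEMA LAW (R9): if ALL additive coincidences of the letter family of `(u, v)` are multiples of ONE datum `(ρ⁺, ρ⁻)` —
ANY datum `ρ⁺, ρ⁻ : Expo →₀ ℕ`, no side condition — then GLOBALLY `#visible ≤ 2^{c m}(#T + 2)^c` (`c = 1416`).  This is the rank-one SCHEMA
quantified over the datum asked for by the Negative lane (val-neg-1 g4, evidence #48 on stmt-5906, item (a)); it SUBSUMES the rungs R3♯
(`permTypeLaw_proof`), R6, R6b, R6c, R7a, R7b, R7c, R8 (each of their hypotheses exhibits a datum).  Engine = the TRANSPORTATION LIFT of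
val-idea-8 g3's memo `Cruxes/TwoProducts/Lines/relation_ladder_R7_engine.md` §1 / `…R8_engine.md` §5 made uniform: for the disjoint balanced
relation `Σ_{i ∈ P} p_i • α_i = Σ_{j ∈ N} q_j • β_j` the atoms are `Z_{ij}`, `(i, j) ∈ P × N` (upstairs index type `σ ⊕ σ × σ`: free letters on
the left, atoms on the right), `Y_{α_i} ↦ ∏_j Z_{ij}^{q_j}`, `Y_{β_j} ↦ ∏_i Z_{ij}^{p_i}`; the planar push-forward is the PRODUCT PLAN
`E'(Z_{ij})_c = (α_i)_c (β_j)_c T'_{1-c}` over the `D = T'_0 T'_1`-dilated plane (`T_c = Σ_i p_i (α_i)_c`, `T' = max(T, 1)`), the upstairs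
weights are the PRODUCT PLAN `θ_{ij} = r_i r_j / R` of the letter weights (pointwise positive, NOT a pull-back; balanced because
`Σ p_i r_i = Σ q_j r_j`); the fibre over an atom monomial is parametrised by `κ = #α_{a₀}` with a CONSISTENCY guard over all `|P|·|N|` atom
equations; SLICING by the atom exponents (≤ `2^{3m}` slices through the simplex `R8.card_W_le`); the coefficient theorem
`Pfac · C(R + B_κ − 1, B_κ) · κ_κ` and the shift rank `2m(ΣA + 1)² + 1` are shape-independent (the free letters enter only through the binomial);
`ShiftRank.pencilCount` BY NAME.  Reductions: common part of the datum (`DatumExcess.rankOne_reduce`), large / absent coefficients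
(`R7a.permType_of_rankOne_largeCoeff/absent`), wide sides (`permType_of_rankOne_wideSide`), and a non-permutation coincidence balances the
datum and makes both sides non-empty (`sides_of_shift`, over val-neg-1 g4's `OneSidedMembership.weight_*` / `DatumExcess.*`).

AUTHORSHIP / LANE NOTE (val-lit-p3 g16, prover seat, KEEP lineage, helper mode `--supports stmt-ValiantsHypothesis-5906 --as helper`;
CLAIM #1 on the val-lit bus 14:45Z 2026-08-28, ★ 15:03Z; no val-idea-8 seat alive at the time — the typed target is staged for the line
owner as `HOME/lmr/staged/p3g16-R9/sketch_R9.lean`, and the closing theorem is stated by its LITERAL BODY so that a later skeleton can wire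
`stub := R9.rankOneSchemaLaw_proof` by name).  Mathematics and Lean text of this module: this seat, generalising its predecessor's R8 port
(`…RankOneOneSidedLaw*`, val-lit-p3 g15) decl by decl.  Reused BY NAME: `R6b.HSD` (+ closure lemmas), `R7b.dilE`/`piT_dilE`/`piE_dilE`,
`R7a.choose_bridge`, `R7a.permType_of_rankOne_largeCoeff/absent`, `toolBound_mono`, `tab`, `sgn`, `R6b.sum_sgn`, `rW`/`R6b.rW_pos`, `lwt_piT`,
`PlanarCell.eq_of_nsmul_eq`/`wt_sum`, `FormalLogLinearisation.wt_nsmul`, `R8.W`/`R8.card_W_le`, `ShiftRank.pencilCount`,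
`BinExpSum.pencilCount_arith`, val-neg-1 g4's `DatumExcess.*`, `RankOneCoverage.eq_of_tsub_eq_zero`, `OneSidedMembership.*`.
Namespace `…PermutationType.R9`.  Nothing here closes the line's residual (`ResidualLawV20`), the crux `TwoProducts` (5906) or `VP ≠ VNP`;
no summit statement is proved.

Honest scope: coincidence modules of RANK ≥ 2 (val-neg-1 g4's p635223 `RankTwoEscapes`) are NOT covered; after R9 the residual of the line is
«no lattice-small permutation-type contraction (R5), no cheap class cover (R1_r), coincidence rank ≥ 2».  Nothing here moves VP ≠ VNP;
`TwoProducts` (5906) / `PlanarCellBound` stay OPEN. [folklore]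

Cut table (scratch `HOME/lmr/staged/p3g16-R9/R9-Scratch.lean`, 2 249 lines, rc 0 / 0 warnings / 0 sorries, axioms standard): part 1 `…Lift` =
T2 (`GIdx`, `P`/`N`/`rel`/`rest`, `frM` and its coordinates, `Idle`, the table sums `sum_frM_inl/inr`); part 2 `…Fibres` = T3 (`xhat`, `Lrel`,
`Lof`, `Adm`, `sA`, `KR`, `eq_Lof_of_piT`, `piT_Lof`, degrees, `Bk`, `Pfac`, `kap`, `multinomial_Lof_eq`, `coeff_phiT_frM`); part 3 `…Slice` =
T4 slice functions, THE COEFFICIENT THEOREM `coeff_free_logTrunc`, T5 finite shift rank `Fsl_shift`; part 4 `…SliceExc` = the exceptional point,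
`mem_support_free_logTrunc_iff`, `Fsl_zero_zero`, `xOf`, `Fsl_congr`; part 5 `…Planar` = T7 `RelDataG`, `D`, `cell`, `enumP`, `piE_enumP_frM`,
`phi_GT`, `injOn_of_rankOne`, `lifted_of_visible`; part 6 `…Weights` = product-plan weights `θW`, `lwt_θW_frM`, `lwt_splitG`, T8
`sliceMin_of_visible`; part 7 `…Count` = `sliceCount`, `RelDataG.count`, `permType_of_rankOne_wideSide`, `sides_of_shift`, `sum_enum_smul_eq`,
`mapDomain_enum_table`; part 8 `…Law` = arithmetic (`c = 1416`), `rankOneSchemaLaw_proof`.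
-/

noncomputable section

-- Sub = Summit single-conjunct layout: the duplicated namespace component is mandated by the tree.
set_option linter.dupNamespace false
set_option linter.unusedSimpArgs false
set_option linter.unusedSectionVars false
set_option linter.unusedVariables false

namespace Summit.ValiantsHypothesis.ValiantsHypothesis.Theorems.NewtonUnitEquations.TwoProducts.PermutationType
namespace R9
open scoped BigOperators
open MvPolynomial

variable {σ : Type*} [Fintype σ] [DecidableEq σ]

/-! ## Part T2: general single-relation data and the transportation substitution -/

/-- General (two-sided) single-relation data on an index type: the `P`-side coefficient function `pf`, the `N`-side coefficient
function `qf` (disjoint supports), and one distinguished letter on each side (`a₀ ∈ P`, `b₀ ∈ N`). [folklore] -/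
structure GIdx (σ : Type*) where
  /-- `P`-side coefficients (`0` off the `P` letters) -/
  pf : σ → ℕ
  /-- `N`-side coefficients (`0` off the `N` letters) -/
  qf : σ → ℕ
  /-- a distinguished `P` letter -/
  a₀ : σ
  /-- a distinguished `N` letter -/
  b₀ : σ
  hpa : pf a₀ ≠ 0
  hqb : qf b₀ ≠ 0
  hdisj : ∀ k, pf k = 0 ∨ qf k = 0

variable (Itr : GIdx σ)

/-- The `P` letters. [folklore] -/
def P : Finset σ := Finset.univ.filter fun k => Itr.pf k ≠ 0

/-- The `N` letters. [folklore] -/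
def N : Finset σ := Finset.univ.filter fun k => Itr.qf k ≠ 0

/-- The relation letters `P ∪ N`. [folklore] -/
def rel : Finset σ := Finset.univ.filter fun k => ¬ (Itr.pf k = 0 ∧ Itr.qf k = 0)

/-- The free letters (outside the relation). [folklore] -/
def rest : Finset σ := Finset.univ.filter fun k => Itr.pf k = 0 ∧ Itr.qf k = 0

/-- Membership in `P`. [folklore] -/
theorem mem_P (k : σ) : k ∈ P Itr ↔ Itr.pf k ≠ 0 := by unfold P; simp

/-- Membership in `N`. [folklore] -/
theorem mem_N (k : σ) : k ∈ N Itr ↔ Itr.qf k ≠ 0 := by unfold N; simp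

/-- Membership in the relation letters. [folklore] -/
theorem mem_rel (k : σ) : k ∈ rel Itr ↔ ¬ (Itr.pf k = 0 ∧ Itr.qf k = 0) := by unfold rel; simp

/-- Membership in the free letters. [folklore] -/
theorem mem_rest (k : σ) : k ∈ rest Itr ↔ Itr.pf k = 0 ∧ Itr.qf k = 0 := by unfold rest; simp

/-- `a₀ ∈ P`. [folklore] -/
theorem a₀_mem_P : Itr.a₀ ∈ P Itr := (mem_P Itr _).2 Itr.hpa

/-- `b₀ ∈ N`. [folklore] -/
theorem b₀_mem_N : Itr.b₀ ∈ N Itr := (mem_N Itr _).2 Itr.hqb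

/-- A `P` letter has `qf = 0`. [folklore] -/
theorem qf_eq_zero_of_mem_P {k : σ} (hk : k ∈ P Itr) : Itr.qf k = 0 := by
  rw [mem_P] at hk; rcases Itr.hdisj k with h | h
  · exact absurd h hk
  · exact h

/-- An `N` letter has `pf = 0`. [folklore] -/
theorem pf_eq_zero_of_mem_N {k : σ} (hk : k ∈ N Itr) : Itr.pf k = 0 := by
  rw [mem_N] at hk; rcases Itr.hdisj k with h | h
  · exact h
  · exact absurd h hk

/-- `qf a₀ = 0`. [folklore] -/
theorem qf_a₀ : Itr.qf Itr.a₀ = 0 := qf_eq_zero_of_mem_P Itr (a₀_mem_P Itr)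

/-- `pf b₀ = 0`. [folklore] -/
theorem pf_b₀ : Itr.pf Itr.b₀ = 0 := pf_eq_zero_of_mem_N Itr (b₀_mem_N Itr)

/-- `a₀ ≠ b₀`. [folklore] -/
theorem a₀_ne_b₀ : Itr.a₀ ≠ Itr.b₀ := fun h => Itr.hpa (by rw [h]; exact pf_b₀ Itr)

/-- `P` letters are relation letters. [folklore] -/
theorem mem_rel_of_mem_P {k : σ} (hk : k ∈ P Itr) : k ∈ rel Itr := by
  rw [mem_rel]; rw [mem_P] at hk; exact fun h => hk h.1

/-- `N` letters are relation letters. [folklore] -/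
theorem mem_rel_of_mem_N {k : σ} (hk : k ∈ N Itr) : k ∈ rel Itr := by
  rw [mem_rel]; rw [mem_N] at hk; exact fun h => hk h.2

/-- `P` and `N` are disjoint. [folklore] -/
theorem disjoint_P_N : Disjoint (P Itr) (N Itr) := by
  rw [Finset.disjoint_left]
  intro k hkP hkN
  exact ((mem_N Itr k).1 hkN) (qf_eq_zero_of_mem_P Itr hkP)

/-- The relation letters are `P ∪ N`. [folklore] -/
theorem rel_eq_union : rel Itr = P Itr ∪ N Itr := by
  ext k
  rw [mem_rel, Finset.mem_union, mem_P, mem_N]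
  tauto

/-- Splitting a product over `σ` into free letters × relation letters. [folklore] -/
theorem prod_split {β : Type*} [CommMonoid β] (f : σ → β) :
    ∏ k, f k = (∏ k ∈ rest Itr, f k) * ∏ k ∈ rel Itr, f k := by
  unfold rest rel
  exact (Finset.prod_filter_mul_prod_filter_not Finset.univ (fun k => Itr.pf k = 0 ∧ Itr.qf k = 0) f).symm

/-- Splitting a sum over `σ` into free letters + relation letters. [folklore] -/
theorem sum_split {β : Type*} [AddCommMonoid β] (f : σ → β) :
    ∑ k, f k = (∑ k ∈ rest Itr, f k) + ∑ k ∈ rel Itr, f k := by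
  unfold rest rel
  exact (Finset.sum_filter_add_sum_filter_not Finset.univ (fun k => Itr.pf k = 0 ∧ Itr.qf k = 0) f).symm

/-- Splitting a product over the relation letters into the two sides. [folklore] -/
theorem prod_rel {β : Type*} [CommMonoid β] (f : σ → β) :
    ∏ k ∈ rel Itr, f k = (∏ k ∈ P Itr, f k) * ∏ k ∈ N Itr, f k := by
  rw [rel_eq_union, Finset.prod_union (disjoint_P_N Itr)]

/-- Splitting a sum over the relation letters into the two sides. [folklore] -/
theorem sum_rel {β : Type*} [AddCommMonoid β] (f : σ → β) :
    ∑ k ∈ rel Itr, f k = (∑ k ∈ P Itr, f k) + ∑ k ∈ N Itr, f k := by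
  rw [rel_eq_union, Finset.sum_union (disjoint_P_N Itr)]

/-- The table of the transportation substitution: the free letter `k` goes to the upstairs variable `inl k`, a `P` letter `i` to
`Σ_{j ∈ N} qf j • Z_{ij}`, an `N` letter `j` to `Σ_{i ∈ P} pf i • Z_{ij}`. [folklore] -/
def frFun (k : σ) : σ ⊕ σ × σ → ℕ
  | Sum.inl k' => if k' = k ∧ Itr.pf k = 0 ∧ Itr.qf k = 0 then 1 else 0
  | Sum.inr ij => if Itr.pf ij.1 ≠ 0 ∧ Itr.qf ij.2 ≠ 0 then
      (if ij.1 = k then Itr.qf ij.2 else 0) + (if ij.2 = k then Itr.pf ij.1 else 0) else 0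

/-- The transportation substitution on letters. [folklore] -/
def frM (k : σ) : σ ⊕ σ × σ →₀ ℕ := ofFun (frFun Itr k)

/-- The substitution at a free coordinate. [folklore] -/
theorem frM_inl (k k' : σ) : frM Itr k (Sum.inl k') = if k' = k ∧ Itr.pf k = 0 ∧ Itr.qf k = 0 then 1 else 0 := by
  unfold frM; rw [ofFun_apply]; rfl

/-- The substitution at an atom coordinate. [folklore] -/
theorem frM_inr (k i j : σ) : frM Itr k (Sum.inr (i, j)) = if Itr.pf i ≠ 0 ∧ Itr.qf j ≠ 0 then
    (if i = k then Itr.qf j else 0) + (if j = k then Itr.pf i else 0) else 0 := by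
  unfold frM; rw [ofFun_apply]; rfl

/-- Every `frM k` is nonzero. [folklore] -/
theorem frM_ne_zero (k : σ) : frM Itr k ≠ 0 := by
  intro h
  by_cases hr : Itr.pf k = 0 ∧ Itr.qf k = 0
  · have := DFunLike.congr_fun h (Sum.inl k)
    rw [frM_inl, if_pos ⟨rfl, hr⟩] at this
    exact one_ne_zero this
  · rcases Itr.hdisj k with hp | hq
    · have hq : Itr.qf k ≠ 0 := fun hq => hr ⟨hp, hq⟩
      have := DFunLike.congr_fun h (Sum.inr (Itr.a₀, k))
      rw [frM_inr, if_pos ⟨Itr.hpa, hq⟩, if_pos rfl] at this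
      simp only [Finsupp.coe_zero, Pi.zero_apply] at this
      have h1 := Itr.hpa
      omega
    · have hp : Itr.pf k ≠ 0 := fun hp => hr ⟨hp, hq⟩
      have := DFunLike.congr_fun h (Sum.inr (k, Itr.b₀))
      rw [frM_inr, if_pos ⟨hp, Itr.hqb⟩, if_pos rfl] at this
      simp only [Finsupp.coe_zero, Pi.zero_apply] at this
      have h1 := Itr.hqb
      omega

/-- A free coordinate of a toric image: the multiplicity of that free letter (zero at a relation letter). [folklore] -/
theorem piT_frM_inl (L : σ →₀ ℕ) (k : σ) :
    piT (frM Itr) L (Sum.inl k) = if Itr.pf k = 0 ∧ Itr.qf k = 0 then L k else 0 := by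
  rw [piT_apply]
  simp only [frM_inl]
  by_cases hk : Itr.pf k = 0 ∧ Itr.qf k = 0
  · rw [if_pos hk]
    rw [Finset.sum_eq_single k]
    · rw [if_pos ⟨rfl, hk⟩, mul_one]
    · intro i _ hik
      rw [if_neg (fun h => hik h.1.symm), mul_zero]
    · intro h; exact absurd (Finset.mem_univ k) h
  · rw [if_neg hk]
    refine Finset.sum_eq_zero fun i _ => ?_
    rw [if_neg, mul_zero]
    rintro ⟨rfl, h⟩
    exact hk h

/-- An atom coordinate of a toric image: `qf j · #α_i + pf i · #β_j` (zero off the atoms). [folklore] -/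
theorem piT_frM_inr (L : σ →₀ ℕ) (i j : σ) :
    piT (frM Itr) L (Sum.inr (i, j)) = if Itr.pf i ≠ 0 ∧ Itr.qf j ≠ 0 then Itr.qf j * L i + Itr.pf i * L j else 0 := by
  rw [piT_apply]
  simp only [frM_inr]
  by_cases hij : Itr.pf i ≠ 0 ∧ Itr.qf j ≠ 0
  · simp only [if_pos hij, mul_add, Finset.sum_add_distrib, mul_ite, mul_zero, Finset.sum_ite_eq,
      Finset.mem_univ, if_true]
    ring
  · simp only [if_neg hij, mul_zero, Finset.sum_const_zero]

/-- An atom coordinate of a toric image at an atom. [folklore] -/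
theorem piT_frM_atom (L : σ →₀ ℕ) {i j : σ} (hi : i ∈ P Itr) (hj : j ∈ N Itr) :
    piT (frM Itr) L (Sum.inr (i, j)) = Itr.qf j * L i + Itr.pf i * L j := by
  rw [piT_frM_inr, if_pos ⟨(mem_P Itr i).1 hi, (mem_N Itr j).1 hj⟩]

/-- A free coordinate of a toric image at a free letter. [folklore] -/
theorem piT_frM_rest (L : σ →₀ ℕ) {k : σ} (hk : k ∈ rest Itr) : piT (frM Itr) L (Sum.inl k) = L k := by
  rw [piT_frM_inl, if_pos ((mem_rest Itr k).1 hk)]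

/-- Upstairs exponents supported on the free coordinates of free letters and on the atoms. [folklore] -/
def Idle (x : σ ⊕ σ × σ →₀ ℕ) : Prop :=
  (∀ k, ¬ (Itr.pf k = 0 ∧ Itr.qf k = 0) → x (Sum.inl k) = 0) ∧
    ∀ i j, ¬ (Itr.pf i ≠ 0 ∧ Itr.qf j ≠ 0) → x (Sum.inr (i, j)) = 0

/-- Toric images are so supported. [folklore] -/
theorem idle_piT (L : σ →₀ ℕ) : Idle Itr (piT (frM Itr) L) :=
  ⟨fun k hk => by rw [piT_frM_inl, if_neg hk], fun i j hij => by rw [piT_frM_inr, if_neg hij]⟩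

/-- Sums against the free rows of the substitution table. [folklore] -/
theorem sum_frM_inl {R : Type*} [CommSemiring R] (f : σ → R) (k : σ) :
    ∑ k', ((frM Itr k (Sum.inl k') : ℕ) : R) * f k' = if Itr.pf k = 0 ∧ Itr.qf k = 0 then f k else 0 := by
  by_cases hk : Itr.pf k = 0 ∧ Itr.qf k = 0
  · rw [if_pos hk, Finset.sum_eq_single k]
    · rw [frM_inl, if_pos ⟨rfl, hk⟩]; simp
    · intro k' _ hk'; rw [frM_inl, if_neg (fun h => hk' h.1)]; simp
    · intro h; exact absurd (Finset.mem_univ k) h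
  · rw [if_neg hk]
    exact Finset.sum_eq_zero fun k' _ => by rw [frM_inl, if_neg (fun h => hk h.2)]; simp

/-- Sums against the atom rows of the substitution table. [folklore] -/
theorem sum_frM_inr {R : Type*} [CommSemiring R] (g : σ → σ → R) (k : σ) :
    ∑ i, ∑ j, ((frM Itr k (Sum.inr (i, j)) : ℕ) : R) * g i j =
      (if Itr.pf k ≠ 0 then ∑ j ∈ N Itr, (Itr.qf j : R) * g k j else 0) +
        (if Itr.qf k ≠ 0 then ∑ i ∈ P Itr, (Itr.pf i : R) * g i k else 0) := by
  have hsplit : ∀ i j, ((frM Itr k (Sum.inr (i, j)) : ℕ) : R) * g i j =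
      (if i = k then (if Itr.pf i ≠ 0 ∧ Itr.qf j ≠ 0 then (Itr.qf j : R) * g i j else 0) else 0) +
        (if j = k then (if Itr.pf i ≠ 0 ∧ Itr.qf j ≠ 0 then (Itr.pf i : R) * g i j else 0) else 0) := by
    intro i j
    rw [frM_inr]
    by_cases hij : Itr.pf i ≠ 0 ∧ Itr.qf j ≠ 0
    · rw [if_pos hij, if_pos hij, if_pos hij]
      by_cases hi : i = k <;> by_cases hj : j = k <;> simp [hi, hj, add_mul]
    · rw [if_neg hij, if_neg hij, if_neg hij]; simp
  simp_rw [hsplit, Finset.sum_add_distrib]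
  congr 1
  · rw [Finset.sum_eq_single k (fun i _ hik => by simp only [if_neg hik, Finset.sum_const_zero])
      (fun h => absurd (Finset.mem_univ k) h)]
    simp only [eq_self_iff_true, if_true]
    by_cases hp : Itr.pf k ≠ 0
    · rw [if_pos hp]; unfold N; rw [Finset.sum_filter]
      refine Finset.sum_congr rfl fun j _ => ?_
      by_cases hq : Itr.qf j ≠ 0
      · rw [if_pos ⟨hp, hq⟩, if_pos hq]
      · rw [if_neg (fun h => hq h.2), if_neg hq]
    · rw [if_neg hp]
      exact Finset.sum_eq_zero fun j _ => by rw [if_neg (fun h => hp h.1)]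
  · rw [Finset.sum_comm]
    rw [Finset.sum_eq_single k (fun j _ hjk => by rw [Finset.sum_eq_zero]; intro i _; rw [if_neg hjk])
      (fun h => absurd (Finset.mem_univ k) h)]
    simp only [if_pos rfl, if_true]
    by_cases hq : Itr.qf k ≠ 0
    · rw [if_pos hq]; unfold P; rw [Finset.sum_filter]
      refine Finset.sum_congr rfl fun i _ => ?_
      by_cases hp : Itr.pf i ≠ 0
      · rw [if_pos ⟨hp, hq⟩, if_pos hp]
      · rw [if_neg (fun h => hp h.1), if_neg hp]
    · rw [if_neg hq]
      exact Finset.sum_eq_zero fun i _ => by rw [if_neg (fun h => hq h.2)]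

end R9
end Summit.ValiantsHypothesis.ValiantsHypothesis.Theorems.NewtonUnitEquations.TwoProducts.PermutationType

end
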